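import Summits.AtomisticToContinuum.Crystallization.Theorems.FrustratedLawDichotomyFrustrationDensityGapDoor

/-!
# FrustratedLawDichotomy · the ENERGETIC residual of the column, cut by STRAIN CURRENCY and by RANGE
# (decomp-a2c, lens-5 «finite/base range + asymptotic regime + bridge», generation 33 — RESIDUAL MODE, D-0179)

State of record (critic rows 452/463/474, census v15 R15): on the `AperiodicFrustratedLawGap` column (crux of item 27623) the door
`MuEquilibriumDoor` is CLOSED (p816834), the nine-piece geometric cut `KR2_shape ⟸ G ∧ P ∧ M` is typed, proved and (M) laddered
(p825369–p825523); what remains is the ENERGETIC input.  In finite currency the door consumes exactly the FRUSTRATION DENSITY GAP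
`FDG` («some `κ > 0`, `C` price every finite `7/10`-separated Lennard-Jones cluster by `κ·N − C·#(robustly close-packed sites) ≤ U − N·e⋆`»,
`FrustratedLawDichotomyFrustrationDensityGapDoor.aperiodicFrustratedLawGap_of_frustrationDensityGap`), so far fed only through
`ChargedEnergyGap ∧ KR2_shape`.  This file types `FDG` verbatim (`FDG`, `fdg_iff`) and cuts IT, twice, with every kernel proved:

* §3 **STRAIN-CURRENCY CONJUNCT SPLIT** `FDG ⟺ ElasticPricing (1/20) η₁ ∧ TopologicalPricing (1/20) η₁` (every `η₁ ≥ 1/20`; both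
  directions, `fdg_iff_elastic_and_topological`).  With the SAME two-shell fit predicate read at two tolerances — tight `η < 1/20` (the
  door's «robustly good», `GoodAt (1/20)`) and loose `η < η₁` (`GoodAt η₁`, «locally crystalline, possibly strained») — the sites of a
  cluster fall into GOOD `g`, STRAINED `ℓ − g` and TOPOLOGICAL `N − ℓ` (`ℓ = goodCount η₁`, `g = goodCount (1/20)`):
  `ElasticPricing`   (E′) «`κ_E·(ℓ − g) − C_E·g − D_E·(N − ℓ) ≤ U − N e⋆`» — strained sites priced, good AND topological sites free
                      (the ASYMPTOTIC = near-crystal regime: geometric rigidity + Cauchy–Born; intrinsic margin = the elastic cost);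
  `TopologicalPricing` (T′) «`κ_T·(N − ℓ) − C_T·g ≤ U − N e⋆`» — loosely-bad sites priced, good sites free, strained sites NEUTRAL
                      (the glass / dilute-defect gap in a currency that homogeneous strain below `η₁` cannot counterfeit).
  Kernel `fdg_of_elastic_of_topological`: the positive combination `κ_T·(E′) + (D_E⁺ + κ_T)·(T′)`.
* §2/§4 **RANGE CUT** (the lens): `V_LJ = truncLJ R + tailLJ R` (sharp cut at range `R`, `interactionEnergy_split`); the attractive tail over
  a `7/10`-separated cluster is floored by a ONE-BODY DENSITY PROXY, `TailFloor R A` «`−A·Σ_i min(nn_i,1)⁻³ ≤ Σ_{i<j} tailLJ R (r_ij)`»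
  (KNOWN-type: disjoint half-balls `B(y_i, min(nn_i,1)/2)`, bi-subharmonic mean value of `|x|⁻⁶`, Young ⟹ `A_R = (2/3)(R−1)⁻³`; the tree's
  `FrustratedLawDichotomyGSCVanHoveBalls.abs_tsum_field_le_of_far` is the crude ancestor), the reference level is a certified periodic upper
  bound `PeriodicEnergyCeiling eUp` (tree: `e⋆ ≤ −0.7175`), and the residual is FINITE-RANGE:
  `T′ ⟸ TailFloor R A ∧ PeriodicEnergyCeiling eUp ∧ FiniteRangeTopologicalPricing (1/20) η₁ R A eUp κ_T C_T` (`topologicalPricing_of_rangeCut`),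
  `FDG ⟸ TailFloor R A ∧ PeriodicEnergyCeiling eUp ∧ FiniteRangeFrustrationGap R A e₁ C ∧ (eUp < e₁)` (`fdg_of_rangeCut`, the unsplit variant).
* §5 literal instances at the MEASURED bite points (`R = 5`, `A = 1/96` beneath T′ at `η₁ = 1/8`; `R = 7`, `A = 1/324` beneath FDG) and the
  crux / sibling BY NAME (`aperiodicFrustratedLawGap_of_split`, `…_of_split_rangeCut`, `…_of_rangeCut`).

MEASURED (HOME/decomp-a2c-lens-5/g33/scripts/rangecut.py, pure python): the best constant any linear pricing can have is pinned by
HOMOGENEOUS STRAIN — charge currency `θ = 1/100` (CEG/PriceTol): `κ ≤ 2.9·10⁻⁴` (a 1 % shear of fcc breaks the 1 %-bonds); tight fit `1/20`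
(FDG): `κ ≤ 3.6·10⁻³` (3.7 % basal shear of hcp); loose fit `1/8` with the clean-gap clause (T′): `κ ≤ 1.63·10⁻²` (12 % Bain compression of
fcc; bcc `+3.1·10⁻²`, A15 `+8.6·10⁻²`).  Against the provable tail slack `ε_R = A_R·s⋆⁻³ − |t_{≥R}(fcc⋆)|` (`0.018, 0.0070, 0.0034, 0.0018,
0.0011` at `R = 4…8`) the range cut BITES at `R = 5` beneath T′ (margin ×2.3), at `R = 7` beneath FDG directly (×2.0), and NOT below `R ≈ 30`
in charge currency through the `CEG ∧ KR2` door (price ÷13).  All statements `[folklore]` bookkeeping; no new analysis is claimed proved here.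
-/

noncomputable section

namespace Summit.AtomisticToContinuum.Crystallization.Theorems.FrustratedLawDichotomyRangeCut

open scoped BigOperators
open Literature.MathematicalPhysics.StatisticalMechanics (interactionEnergy lennardJones PeriodicConfiguration)
open Literature.Geometry.DiscreteGeometry (nearestDist)
open Summit.AtomisticToContinuum.Crystallization.Theorems.ChargedEnergyGapNegative (E3 eStar eStar_le)
open Summit.AtomisticToContinuum.Crystallization.Theorems.FrustratedLawDichotomyFrustrationDensityGapDoor
  (aperiodicFrustratedLawGap_of_frustrationDensityGap periodicFrustratedLawGap_of_frustrationDensityGap rGSC_of_frustrationDensityGap)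

/-! ## §1. The door's finite currency, typed: `GoodAt`, `goodCount`, `Sep`, `FDG` (verbatim) -/

/-- **Hard-core separation `7/10`** of a finite cluster (the standing hypothesis of the door's finite currency). -/
def Sep {N : ℕ} (y : Fin N → EuclideanSpace ℝ (Fin 3)) : Prop :=
  ∀ a b : Fin N, a ≠ b → (7 : ℝ) / 10 ≤ dist (y a) (y b)

/-- **The two-shell fit predicate at tolerance `ηmax`**: the site `i` of `y` is fcc- or hcp-kissing-pattern GOOD — some isometric copy of the
pattern at the site's own nearest-neighbour scale `d = nn_i` fits twelve configuration points within `η·d`, `η < ηmax`, and the shell below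
`13/10·d` is clean (text = the door's «robustly good» set with `1/20` replaced by `ηmax`; `GoodAt (1/20)` is it verbatim). -/
def GoodAt (ηmax : ℝ) {N : ℕ} (y : Fin N → EuclideanSpace ℝ (Fin 3)) (i : Fin N) : Prop :=
  ∃ (d η γ : ℝ) (A : EuclideanSpace ℝ (Fin 3) →ₗᵢ[ℝ] EuclideanSpace ℝ (Fin 3)), (∃ t : ↥Literature.Geometry.DiscreteGeometry.fccKissingPattern → EuclideanSpace ℝ (Fin 3), 0 < d ∧ 0 < γ ∧ η < ηmax ∧ (∀ u : ↥Literature.Geometry.DiscreteGeometry.fccKissingPattern, t u ∈ (Set.range y) ∧ ‖(t u - (y i)) - d • A (u : EuclideanSpace ℝ (Fin 3))‖ ≤ η * d) ∧ (∀ s : EuclideanSpace ℝ (Fin 3), s ∈ (Set.range y) → s ≠ (y i) → d ≤ dist s (y i)) ∧ (∃ s : EuclideanSpace ℝ (Fin 3), s ∈ (Set.range y) ∧ s ≠ (y i) ∧ dist s (y i) ≤ d) ∧ (∀ s : EuclideanSpace ℝ (Fin 3), s ∈ (Set.range y) → s ≠ (y i) → dist s (y i) < 13 / 10 * d + γ →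 dist s (y i) ≤ 13 / 10 * d - γ ∧ s ∈ Set.range t)) ∨ (∃ t : ↥Literature.Geometry.DiscreteGeometry.hcpKissingPattern → EuclideanSpace ℝ (Fin 3), 0 < d ∧ 0 < γ ∧ η < ηmax ∧ (∀ u : ↥Literature.Geometry.DiscreteGeometry.hcpKissingPattern, t u ∈ (Set.range y) ∧ ‖(t u - (y i)) - d • A (u : EuclideanSpace ℝ (Fin 3))‖ ≤ η * d) ∧ (∀ s : EuclideanSpace ℝ (Fin 3), s ∈ (Set.range y) → s ≠ (y i) → d ≤ dist s (y i)) ∧ (∃ s : EuclideanSpace ℝ (Fin 3), s ∈ (Set.range y) ∧ s ≠ (y i) ∧ dist s (y i) ≤ d) ∧ (∀ s : EuclideanSpace ℝ (Fin 3), s ∈ (Set.range y) → s ≠ (y i) → dist s (y i) < 13 / 10 * d + γ → dist s (y i) ≤ 13 / 10 * d - γ ∧ s ∈ Set.range t))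

/-- **`goodCount ηmax y = #{i : GoodAt ηmax y i}`**. -/
def goodCount (ηmax : ℝ) {N : ℕ} (y : Fin N → EuclideanSpace ℝ (Fin 3)) : ℕ :=
  Nat.card {i : Fin N // GoodAt ηmax y i}

/-- **FDG — the frustration density gap**, text VERBATIM the hypothesis `hFDG` of
`FrustratedLawDichotomyFrustrationDensityGapDoor.aperiodicFrustratedLawGap_of_frustrationDensityGap` (so the crux follows BY NAME, §5). -/
def FDG : Prop :=
  ∃ κ : ℝ, 0 < κ ∧ ∃ C : ℝ, ∀ (N : ℕ) (y : Fin N → EuclideanSpace ℝ (Fin 3)), Function.Injective y → (∀ a b : Fin N, a ≠ b → (7 : ℝ) / 10 ≤ dist (y a) (y b)) → κ * N - C * (Nat.card {i : Fin N // ∃ (d η γ : ℝ) (A : EuclideanSpace ℝ (Fin 3) →ₗᵢ[ℝ] EuclideanSpace ℝ (Fin 3)), (∃ t : ↥Literature.Geometry.DiscreteGeometry.fccKissingPattern → EuclideanSpace ℝ (Fin 3), 0 < d ∧ 0 < γ ∧ η < 1 / 20 ∧ (∀ u : ↥Literature.Geometry.DiscreteGeometry.fccKissingPattern, t u ∈ (Set.range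 y) ∧ ‖(t u - (y i)) - d • A (u : EuclideanSpace ℝ (Fin 3))‖ ≤ η * d) ∧ (∀ s : EuclideanSpace ℝ (Fin 3), s ∈ (Set.range y) → s ≠ (y i) → d ≤ dist s (y i)) ∧ (∃ s : EuclideanSpace ℝ (Fin 3), s ∈ (Set.range y) ∧ s ≠ (y i) ∧ dist s (y i) ≤ d) ∧ (∀ s : EuclideanSpace ℝ (Fin 3), s ∈ (Set.range y) → s ≠ (y i) → dist s (y i) < 13 / 10 * d + γ → dist s (y i) ≤ 13 / 10 * d - γ ∧ s ∈ Set.range t)) ∨ (∃ t : ↥Literature.Geometry.DiscreteGeometry.hcpKissingPattern → EuclideanSpace ℝ (Fin 3), 0 < d ∧ 0 < γ ∧ η < 1 / 20 ∧ (∀ u : ↥Literature.Geometry.DiscreteGeometry.hcpKissingPattern, t u ∈ (Set.range y) ∧ ‖(t u - (y i)) - d • A (u : EuclideanSpace ℝ (Fin 3))‖ ≤ η * d) ∧ (∀ s : EuclideanSpace ℝ (Fin 3), s ∈ (Set.range y) → s ≠ (y i) → d ≤ dist s (y i)) ∧ (∃ s : EuclideanSpace ℝ (Fin 3), s ∈ (Set.range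 y) ∧ s ≠ (y i) ∧ dist s (y i) ≤ d) ∧ (∀ s : EuclideanSpace ℝ (Fin 3), s ∈ (Set.range y) → s ≠ (y i) → dist s (y i) < 13 / 10 * d + γ → dist s (y i) ≤ 13 / 10 * d - γ ∧ s ∈ Set.range t))} : ℝ) ≤ Literature.MathematicalPhysics.StatisticalMechanics.interactionEnergy Literature.MathematicalPhysics.StatisticalMechanics.lennardJones y - N * (⨅ Q : Literature.MathematicalPhysics.StatisticalMechanics.PeriodicConfiguration 3, Q.energyPerParticle Literature.MathematicalPhysics.StatisticalMechanics.lennardJones)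

/-- `FDG` in the vocabulary of this file (definitional unfolding). [folklore] -/
theorem fdg_iff :
    FDG ↔ ∃ κ : ℝ, 0 < κ ∧ ∃ C : ℝ, ∀ (N : ℕ) (y : Fin N → EuclideanSpace ℝ (Fin 3)), Function.Injective y → Sep y →
      κ * N - C * (goodCount (1 / 20) y : ℝ) ≤ interactionEnergy lennardJones y - N * eStar :=
  Iff.rfl

/-- Loosening the tolerance keeps a good site good. [folklore] -/
theorem goodAt_mono {η₀ η₁ : ℝ} (h : η₀ ≤ η₁) {N : ℕ} {y : Fin N → EuclideanSpace ℝ (Fin 3)} {i : Fin N}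
    (hi : GoodAt η₀ y i) : GoodAt η₁ y i := by
  obtain ⟨d, η, γ, A, hor⟩ := hi
  refine ⟨d, η, γ, A, ?_⟩
  rcases hor with ⟨t, hd, hγ, hη, hrest⟩ | ⟨t, hd, hγ, hη, hrest⟩
  · exact Or.inl ⟨t, hd, hγ, hη.trans_le h, hrest⟩
  · exact Or.inr ⟨t, hd, hγ, hη.trans_le h, hrest⟩

/-- `goodCount` is monotone in the tolerance. [folklore] -/
theorem goodCount_mono {η₀ η₁ : ℝ} (h : η₀ ≤ η₁) {N : ℕ} (y : Fin N → EuclideanSpace ℝ (Fin 3)) :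
    goodCount η₀ y ≤ goodCount η₁ y :=
  Nat.card_le_card_of_injective (fun i : {i : Fin N // GoodAt η₀ y i} => (⟨i.1, goodAt_mono h i.2⟩ : {i : Fin N // GoodAt η₁ y i}))
    fun a b hab => Subtype.ext (by simpa using congrArg Subtype.val hab)

/-- `goodCount ≤ N`. [folklore] -/
theorem goodCount_le (η : ℝ) {N : ℕ} (y : Fin N → EuclideanSpace ℝ (Fin 3)) : goodCount η y ≤ N := by
  have h := Nat.card_le_card_of_injective (fun i : {i : Fin N // GoodAt η y i} => i.1) fun a b hab => Subtype.ext hab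
  simpa [goodCount, Nat.card_fin] using h

/-! ## §2. The range cut of the potential and the one-body density proxy -/

/-- **Range-`R` truncation of the Lennard-Jones potential** (sharp cut: `V(r)` for `r < R`, `0` beyond). -/
def truncLJ (R : ℝ) (r : ℝ) : ℝ := if r < R then lennardJones r else 0

/-- **The tail beyond range `R`**: `V(r)` for `r ≥ R`, `0` below (attractive, `≤ 0`, once `R ≥ 2^{-1/6}`). -/
def tailLJ (R : ℝ) (r : ℝ) : ℝ := if r < R then 0 else lennardJones r

/-- `V = truncLJ R + tailLJ R` pointwise. [folklore] -/
theorem truncLJ_add_tailLJ (R r : ℝ) : truncLJ R r + tailLJ R r = lennardJones r := by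
  unfold truncLJ tailLJ
  split_ifs <;> simp

/-- Additivity of the interaction energy in the potential. [folklore] -/
theorem interactionEnergy_add {N : ℕ} (V W : ℝ → ℝ) (y : Fin N → EuclideanSpace ℝ (Fin 3)) :
    interactionEnergy (fun r => V r + W r) y = interactionEnergy V y + interactionEnergy W y := by
  simp only [interactionEnergy, Finset.sum_add_distrib]

/-- **RANGE SPLIT of the cluster energy**: `U = U_R + T_R`. [folklore] -/
theorem interactionEnergy_split (R : ℝ) {N : ℕ} (y : Fin N → EuclideanSpace ℝ (Fin 3)) :
    interactionEnergy lennardJones y = interactionEnergy (truncLJ R) y + interactionEnergy (tailLJ R) y := by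
  rw [← interactionEnergy_add]
  congr 1
  funext r
  exact (truncLJ_add_tailLJ R r).symm

/-- **One-body density proxy** `m_i = min(nn_i, 1)⁻³` (`nn_i` = the site's own nearest-neighbour distance, `nearestDist`): the inverse volume,
up to `6/π`, of the half-ball `B(y_i, min(nn_i,1)/2)`; these half-balls are pairwise disjoint, which is what floors the tail. -/
def densityProxy {N : ℕ} (y : Fin N → EuclideanSpace ℝ (Fin 3)) (i : Fin N) : ℝ :=
  ((min (nearestDist y i) 1) ^ 3)⁻¹

/-- `0 ≤ m_i`. [folklore] -/
theorem densityProxy_nonneg {N : ℕ} (y : Fin N → EuclideanSpace ℝ (Fin 3)) (i : Fin N) : 0 ≤ densityProxy y i :=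
  inv_nonneg.mpr (pow_nonneg (le_min (Literature.Geometry.DiscreteGeometry.nearestDist_nonneg y i) zero_le_one) 3)

/-- **TF — TAIL FLOOR at range `R` with constant `A`** (piece · KNOWN-type · ATTACKABLE): over every `7/10`-separated finite cluster the
attractive tail beyond `R` is floored by the one-body density proxy, `−A·Σ_i m_i ≤ Σ_{i<j} tailLJ R (r_ij)`.  Intended proof (constant
`A_R = (2/3)(R−1)⁻³`): for `r_ij ≥ R ≥ 2^{1/6}`, `|V(r_ij)| ≤ r_ij⁻⁶/6 ≤ (1/6)⨍_{B_i}⨍_{B_j}|x−x'|⁻⁶` (subharmonic mean value twice, the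
half-balls `B_k = B(y_k, min(nn_k,1)/2)` being pairwise disjoint and `|x − x'| ≥ R − 1`), then Young:
`Σ_{i≠j} ⨍⨍ ≤ ‖|·|⁻⁶𝟙_{≥R−1}‖₁ · Σ_i vol(B_i)⁻¹ = (4π/3)(R−1)⁻³·(6/π)Σ_i m_i`.  The tree's
`FrustratedLawDichotomyGSCVanHoveBalls.abs_tsum_field_le_of_far` is the crude version (constant `(δ⁻⁶/12+1/6)·1024/(δ³R³)` per site). -/
def TailFloor (R A : ℝ) : Prop :=
  ∀ (N : ℕ) (y : Fin N → EuclideanSpace ℝ (Fin 3)), Function.Injective y → Sep y →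
    -(A * ∑ i, densityProxy y i) ≤ interactionEnergy (tailLJ R) y

/-- `TailFloor` is monotone in the constant. [folklore] -/
theorem tailFloor_mono {R A A' : ℝ} (h : TailFloor R A) (hA : A ≤ A') : TailFloor R A' := fun N y hy hsep => by
  have hs : 0 ≤ ∑ i, densityProxy y i := Finset.sum_nonneg fun i _ => densityProxy_nonneg y i
  have := h N y hy hsep
  nlinarith

/-- **UP — a certified PERIODIC UPPER BOUND `e(Q) ≤ eUp`** (piece · IN THE TREE at `eUp = −0.7175`:
`ThreeConeCertificateOnePercentCertificateFccWindow.energyPerParticle_fccPC_aW_le`; an instrument never needs `e⋆` itself). -/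
-- landing note (hand-2 g11): lens-5 g33's name `PeriodicUpperBound` collides with a route-item name (helper.identity); renamed
-- `PeriodicEnergyCeiling` here and in every use (statements otherwise byte-identical).
def PeriodicEnergyCeiling (eUp : ℝ) : Prop :=
  ∃ Q : PeriodicConfiguration 3, Q.energyPerParticle lennardJones ≤ eUp

/-- `UP(eUp) ⟹ e⋆ ≤ eUp`. [folklore] -/
theorem eStar_le_of_periodicEnergyCeiling {eUp : ℝ} (h : PeriodicEnergyCeiling eUp) : eStar ≤ eUp := by
  obtain ⟨Q, hQ⟩ := h
  exact (eStar_le Q).trans hQ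

/-- **FRG — FINITE-RANGE FRUSTRATION GAP** (the residual of the UNSPLIT range cut · BARRIER TetrahedralFrustration, but finite range by
construction): the range-`R` energy minus the density proxy, `U_R − A·Σ m_i`, lies above the literal level `e₁·N` up to `C` per tightly-good
site.  True only with `e₁ − e⋆` below the strain ceiling `3.6·10⁻³` minus the tail slack `ε_R` (MEASURED: bites at `R = 7`). -/
def FiniteRangeFrustrationGap (R A e₁ C : ℝ) : Prop :=
  ∀ (N : ℕ) (y : Fin N → EuclideanSpace ℝ (Fin 3)), Function.Injective y → Sep y →
    e₁ * N - C * (goodCount (1 / 20) y : ℝ) ≤ interactionEnergy (truncLJ R) y - A * ∑ i, densityProxy y i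

/-- **KERNEL of the unsplit range cut, `e⋆`-form**: `TF(R,A) ∧ (e⋆ ≤ eUp) ∧ FRG(R,A,e₁,C) ∧ (eUp < e₁) ⟹ FDG` (with `κ = e₁ − eUp`;
use with any tree bound, e.g. `ThreeConeCertificateOnePercentCertificateFccRung.eStar_le_neg : e⋆ ≤ −0.711`,
`ThreeConeCertificateOnePercentCertificateFccWindow.eStar_le : e⋆ ≤ −0.7175`). [folklore] -/
theorem fdg_of_rangeCut' {R A eUp e₁ C : ℝ} (hT : TailFloor R A) (hst : eStar ≤ eUp)
    (hF : FiniteRangeFrustrationGap R A e₁ C) (he : eUp < e₁) : FDG := by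
  rw [fdg_iff]
  refine ⟨e₁ - eUp, sub_pos.mpr he, C, fun N y hy hsep => ?_⟩
  have h1 := hT N y hy hsep
  have h2 := hF N y hy hsep
  have hN : (N : ℝ) * eStar ≤ N * eUp := mul_le_mul_of_nonneg_left hst (Nat.cast_nonneg N)
  rw [interactionEnergy_split R y]
  linarith

/-- **KERNEL of the unsplit range cut**: `TF(R,A) ∧ UP(eUp) ∧ FRG(R,A,e₁,C) ∧ (eUp < e₁) ⟹ FDG`. [folklore] -/
theorem fdg_of_rangeCut {R A eUp e₁ C : ℝ} (hT : TailFloor R A) (hU : PeriodicEnergyCeiling eUp)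
    (hF : FiniteRangeFrustrationGap R A e₁ C) (he : eUp < e₁) : FDG :=
  fdg_of_rangeCut' hT (eStar_le_of_periodicEnergyCeiling hU) hF he

/-! ## §3. The strain-currency conjunct split `FDG ⟺ E′ ∧ T′` -/

/-- **E′ — ELASTIC PRICING** between the tolerances `η₀ < η₁` (piece · WEAKER, a proved consequence of `FDG` · ANALYTIC, the near-crystal
regime): STRAINED sites (loosely but not tightly good) are priced linearly, tightly-good and loosely-bad sites are free:
`κ_E·(ℓ − g) − C_E·g − D_E·(N − ℓ) ≤ U − N·e⋆`.  Intrinsic ceiling `κ_E ≤ 3.6·10⁻³` (3.7 % basal shear of hcp, MEASURED). -/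
def ElasticPricing (η₀ η₁ : ℝ) : Prop :=
  ∃ κE : ℝ, 0 < κE ∧ ∃ CE DE : ℝ, ∀ (N : ℕ) (y : Fin N → EuclideanSpace ℝ (Fin 3)), Function.Injective y → Sep y →
    κE * ((goodCount η₁ y : ℝ) - goodCount η₀ y) - CE * goodCount η₀ y - DE * ((N : ℝ) - goodCount η₁ y) ≤
      interactionEnergy lennardJones y - N * eStar

/-- **T′ — TOPOLOGICAL PRICING** at the loose tolerance `η₁` (piece · WEAKER, a proved consequence of `FDG` · BARRIER TetrahedralFrustration ·
cut further by range in §4): LOOSELY-BAD sites are priced linearly, tightly-good sites are free, strained sites neutral: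
`κ_T·(N − ℓ) − C_T·g ≤ U − N·e⋆`.  Ceiling `κ_T ≤ 1.63·10⁻²` at `η₁ = 1/8` (MEASURED). -/
def TopologicalPricing (η₀ η₁ : ℝ) : Prop :=
  ∃ κT : ℝ, 0 < κT ∧ ∃ CT : ℝ, ∀ (N : ℕ) (y : Fin N → EuclideanSpace ℝ (Fin 3)), Function.Injective y → Sep y →
    κT * ((N : ℝ) - goodCount η₁ y) - CT * goodCount η₀ y ≤ interactionEnergy lennardJones y - N * eStar

/-- `FDG ⟹ E′` (drop the nonnegative topological term). [folklore] -/
theorem elasticPricing_of_fdg {η₁ : ℝ} (h : FDG) : ElasticPricing (1 / 20) η₁ := by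
  rw [fdg_iff] at h
  obtain ⟨κ, hκ, C, hC⟩ := h
  refine ⟨κ, hκ, C - κ, 0, fun N y hy hsep => ?_⟩
  have h1 := hC N y hy hsep
  have hb : (goodCount η₁ y : ℝ) ≤ N := by exact_mod_cast goodCount_le η₁ y
  have hb' : κ * (goodCount η₁ y : ℝ) ≤ κ * N := mul_le_mul_of_nonneg_left hb hκ.le
  linarith

/-- `FDG ⟹ T′` (drop the nonnegative strained term; needs `1/20 ≤ η₁`). [folklore] -/
theorem topologicalPricing_of_fdg {η₁ : ℝ} (h01 : (1 : ℝ) / 20 ≤ η₁) (h : FDG) : TopologicalPricing (1 / 20) η₁ := by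
  rw [fdg_iff] at h
  obtain ⟨κ, hκ, C, hC⟩ := h
  refine ⟨κ, hκ, C - κ, fun N y hy hsep => ?_⟩
  have h1 := hC N y hy hsep
  have ha : (goodCount (1 / 20) y : ℝ) ≤ goodCount η₁ y := by exact_mod_cast goodCount_mono h01 y
  have ha' : κ * (goodCount (1 / 20) y : ℝ) ≤ κ * goodCount η₁ y := mul_le_mul_of_nonneg_left ha hκ.le
  linarith

/-- **KERNEL of the strain-currency split**: `E′ ∧ T′ ⟹ FDG` (`1/20 ≤ η₁`), by the positive combination `κ_T·(E′) + (D_E⁺ + κ_T)·(T′)`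
(`a = ℓ − g ≥ 0`, `b = N − ℓ ≥ 0`): `κ_E κ_T·(a + b) ≤ (κ_T + D_E⁺ + κ_E)·X + (κ_T|C_E| + D_E⁺|C_T| + κ_E|C_T|)·g`. [folklore] -/
theorem fdg_of_elastic_of_topological {η₁ : ℝ} (h01 : (1 : ℝ) / 20 ≤ η₁)
    (hE : ElasticPricing (1 / 20) η₁) (hT : TopologicalPricing (1 / 20) η₁) : FDG := by
  rw [fdg_iff]
  obtain ⟨κE, hκE, CE, DE, hE⟩ := hE
  obtain ⟨κT, hκT, CT, hT⟩ := hT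
  set D := max DE 0 with hDdef
  have hD0 : 0 ≤ D := le_max_right _ _
  have hDE : DE ≤ D := le_max_left _ _
  set S := κT + D + κE with hSdef
  have hS : 0 < S := by positivity
  set M := κT * |CE| + D * |CT| + κE * |CT| + κE * κT with hMdef
  refine ⟨κE * κT / S, div_pos (mul_pos hκE hκT) hS, M / S, fun N y hy hsep => ?_⟩
  have h1 := hE N y hy hsep
  have h2 := hT N y hy hsep
  set X := interactionEnergy lennardJones y - N * eStar with hX
  set g : ℝ := (goodCount (1 / 20) y : ℝ) with hg
  set l : ℝ := (goodCount η₁ y : ℝ) with hl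
  have hg0 : 0 ≤ g := Nat.cast_nonneg _
  have hgl : g ≤ l := by rw [hg, hl]; exact_mod_cast goodCount_mono h01 y
  have hlN : l ≤ N := by rw [hl]; exact_mod_cast goodCount_le η₁ y
  -- absolute values dominate the good-site coefficients, `D` dominates `DE`
  have hCE : CE * g ≤ |CE| * g := mul_le_mul_of_nonneg_right (le_abs_self CE) hg0
  have hCT : CT * g ≤ |CT| * g := mul_le_mul_of_nonneg_right (le_abs_self CT) hg0
  have hDb : DE * ((N : ℝ) - l) ≤ D * ((N : ℝ) - l) := mul_le_mul_of_nonneg_right hDE (by linarith)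
  -- (E′)·κT, (T′)·D, (T′)·κE
  have hE' : κE * (l - g) ≤ X + |CE| * g + D * ((N : ℝ) - l) := by linarith
  have hT' : κT * ((N : ℝ) - l) ≤ X + |CT| * g := by linarith
  have e1 := mul_le_mul_of_nonneg_left hE' hκT.le
  have e2 := mul_le_mul_of_nonneg_left hT' hD0
  have e3 := mul_le_mul_of_nonneg_left hT' hκE.le
  have hmain : κE * κT * N - M * g ≤ S * X := by
    rw [hMdef, hSdef]
    nlinarith [e1, e2, e3, hg0, hgl, hlN, mul_nonneg hκE.le hκT.le]
  calc κE * κT / S * N - M / S * g = (κE * κT * N - M * g) / S := by field_simp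
    _ ≤ S * X / S := div_le_div_of_nonneg_right hmain hS.le
    _ = X := by field_simp

/-- **THE CONJUNCT SPLIT**: `FDG ⟺ E′(1/20, η₁) ∧ T′(1/20, η₁)` for every `η₁ ≥ 1/20`. [folklore] -/
theorem fdg_iff_elastic_and_topological {η₁ : ℝ} (h01 : (1 : ℝ) / 20 ≤ η₁) :
    FDG ↔ ElasticPricing (1 / 20) η₁ ∧ TopologicalPricing (1 / 20) η₁ :=
  ⟨fun h => ⟨elasticPricing_of_fdg h, topologicalPricing_of_fdg h01 h⟩, fun h => fdg_of_elastic_of_topological h01 h.1 h.2⟩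

/-! ## §4. The range cut beneath T′ -/

/-- **T′_R — FINITE-RANGE TOPOLOGICAL PRICING** (the residual of the split range cut · BARRIER TetrahedralFrustration · finite range `R`):
`eUp·N + κ_T·(N − ℓ) − C_T·g ≤ U_R − A·Σ m_i` with the reference level `eUp` = the certified periodic upper bound (no `e⋆`).  At `η₁ = 1/8`
it is TRUE-type iff `κ_T < 1.63·10⁻² − ε_R − 9·10⁻⁵`: MEASURED bite point `R = 5` (`ε_5 = 7.0·10⁻³`, room `9·10⁻³`; `R = 6`: `1.3·10⁻²`). -/
def FiniteRangeTopologicalPricing (η₀ η₁ R A eUp κT CT : ℝ) : Prop :=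
  ∀ (N : ℕ) (y : Fin N → EuclideanSpace ℝ (Fin 3)), Function.Injective y → Sep y →
    eUp * N + κT * ((N : ℝ) - goodCount η₁ y) - CT * goodCount η₀ y ≤
      interactionEnergy (truncLJ R) y - A * ∑ i, densityProxy y i

/-- **KERNEL of the range cut beneath T′, `e⋆`-form**: `TF(R,A) ∧ (e⋆ ≤ eUp) ∧ T′_R ⟹ T′` (same `κ_T`, `C_T`). [folklore] -/
theorem topologicalPricing_of_rangeCut' {η₀ η₁ R A eUp κT CT : ℝ} (hT : TailFloor R A) (hst : eStar ≤ eUp)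
    (hκ : 0 < κT) (hF : FiniteRangeTopologicalPricing η₀ η₁ R A eUp κT CT) : TopologicalPricing η₀ η₁ := by
  refine ⟨κT, hκ, CT, fun N y hy hsep => ?_⟩
  have h1 := hT N y hy hsep
  have h2 := hF N y hy hsep
  have hN : (N : ℝ) * eStar ≤ N * eUp := mul_le_mul_of_nonneg_left hst (Nat.cast_nonneg N)
  rw [interactionEnergy_split R y]
  linarith

/-- **KERNEL of the range cut beneath T′**: `TF(R,A) ∧ UP(eUp) ∧ T′_R ⟹ T′` (same `κ_T`, `C_T`). [folklore] -/
theorem topologicalPricing_of_rangeCut {η₀ η₁ R A eUp κT CT : ℝ} (hT : TailFloor R A) (hU : PeriodicEnergyCeiling eUp)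
    (hκ : 0 < κT) (hF : FiniteRangeTopologicalPricing η₀ η₁ R A eUp κT CT) : TopologicalPricing η₀ η₁ :=
  topologicalPricing_of_rangeCut' hT (eStar_le_of_periodicEnergyCeiling hU) hκ hF

/-- `T′_R` is monotone: a smaller price `κ_T' ≤ κ_T` and a larger good-site allowance `C_T ≤ C_T'` keep it. [folklore] -/
theorem finiteRangeTopologicalPricing_mono {η₀ η₁ R A eUp κT κT' CT CT' : ℝ} (h : FiniteRangeTopologicalPricing η₀ η₁ R A eUp κT CT)
    (hκ : κT' ≤ κT) (hC : CT ≤ CT') : FiniteRangeTopologicalPricing η₀ η₁ R A eUp κT' CT' := fun N y hy hsep => by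
  have h1 := h N y hy hsep
  have hg0 : (0 : ℝ) ≤ goodCount η₀ y := Nat.cast_nonneg _
  have hb : (goodCount η₁ y : ℝ) ≤ N := by exact_mod_cast goodCount_le η₁ y
  have e1 : κT' * ((N : ℝ) - goodCount η₁ y) ≤ κT * ((N : ℝ) - goodCount η₁ y) := mul_le_mul_of_nonneg_right hκ (by linarith)
  have e2 : CT * (goodCount η₀ y : ℝ) ≤ CT' * goodCount η₀ y := mul_le_mul_of_nonneg_right hC hg0
  linarith

/-- **FDG from the split with T′ range-cut**: `E′(1/20,η₁) ∧ TF(R,A) ∧ UP(eUp) ∧ T′_R ⟹ FDG`. [folklore] -/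
theorem fdg_of_split_rangeCut {η₁ R A eUp κT CT : ℝ} (h01 : (1 : ℝ) / 20 ≤ η₁) (hE : ElasticPricing (1 / 20) η₁)
    (hT : TailFloor R A) (hU : PeriodicEnergyCeiling eUp) (hκ : 0 < κT)
    (hF : FiniteRangeTopologicalPricing (1 / 20) η₁ R A eUp κT CT) : FDG :=
  fdg_of_elastic_of_topological h01 hE (topologicalPricing_of_rangeCut hT hU hκ hF)

/-! ## §5. Literal instances at the measured bite points, and the crux BY NAME -/

/-- **Split range cut at the bite point `R = 5`** (`A_5 = (2/3)/4³ = 1/96`, loose tolerance `η₁ = 1/8`, price `κ_T = 1/200`, reference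
`eUp = −0.7175` = the tree's certified fcc bound): `E′(1/20,1/8) ∧ TF(5, 1/96) ∧ UP(−0.7175) ∧ T′_5 ⟹ FDG`. [folklore] -/
theorem fdg_of_split_rangeCut_five {CT : ℝ} (hE : ElasticPricing (1 / 20) (1 / 8)) (hT : TailFloor 5 (1 / 96))
    (hU : PeriodicEnergyCeiling (-(7175 / 10000)))
    (hF : FiniteRangeTopologicalPricing (1 / 20) (1 / 8) 5 (1 / 96) (-(7175 / 10000)) (1 / 200) CT) : FDG :=
  fdg_of_split_rangeCut (by norm_num) hE hT hU (by norm_num) hF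

/-- **Unsplit range cut at the bite point `R = 7`** (`A_7 = (2/3)/6³ = 1/324`, level `e₁ = −0.7174 > eUp = −0.7175`, i.e. `κ = 10⁻⁴`):
`TF(7, 1/324) ∧ UP(−0.7175) ∧ FRG(7, 1/324, −0.7174, C) ⟹ FDG`. [folklore] -/
theorem fdg_of_rangeCut_seven {C : ℝ} (hT : TailFloor 7 (1 / 324)) (hU : PeriodicEnergyCeiling (-(7175 / 10000)))
    (hF : FiniteRangeFrustrationGap 7 (1 / 324) (-(7174 / 10000)) C) : FDG :=
  fdg_of_rangeCut hT hU hF (by norm_num)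

/-- **The crux `AperiodicFrustratedLawGap` (item 27623) BY NAME from `FDG`**, granted `MuEquilibriumDoor` (item 27073, closed). [folklore] -/
theorem aperiodicFrustratedLawGap_of_fdg
    (hDoor : Summit.AtomisticToContinuum.Crystallization.Theses.GrainCoreNetworkSplit.MuEquilibriumDoor) (h : FDG) :
    Summit.AtomisticToContinuum.Crystallization.Theses.FrustratedLawDichotomy.AperiodicFrustratedLawGap :=
  aperiodicFrustratedLawGap_of_frustrationDensityGap hDoor h

/-- **The sibling `PeriodicFrustratedLawGap` (item 27624) BY NAME from `FDG`**, granted `MuEquilibriumDoor`. [folklore] -/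
theorem periodicFrustratedLawGap_of_fdg
    (hDoor : Summit.AtomisticToContinuum.Crystallization.Theses.GrainCoreNetworkSplit.MuEquilibriumDoor) (h : FDG) :
    Summit.AtomisticToContinuum.Crystallization.Theses.FrustratedLawDichotomy.PeriodicFrustratedLawGap :=
  periodicFrustratedLawGap_of_frustrationDensityGap hDoor h

/-- **THE NODE, crux form**: `MuEquilibriumDoor ∧ E′(1/20,η₁) ∧ T′(1/20,η₁) ⟹ AperiodicFrustratedLawGap` (`η₁ ≥ 1/20`). [folklore] -/
theorem aperiodicFrustratedLawGap_of_split {η₁ : ℝ} (h01 : (1 : ℝ) / 20 ≤ η₁)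
    (hDoor : Summit.AtomisticToContinuum.Crystallization.Theses.GrainCoreNetworkSplit.MuEquilibriumDoor)
    (hE : ElasticPricing (1 / 20) η₁) (hT : TopologicalPricing (1 / 20) η₁) :
    Summit.AtomisticToContinuum.Crystallization.Theses.FrustratedLawDichotomy.AperiodicFrustratedLawGap :=
  aperiodicFrustratedLawGap_of_fdg hDoor (fdg_of_elastic_of_topological h01 hE hT)

/-- **THE NODE with the range cut beneath T′, crux form**:
`MuEquilibriumDoor ∧ E′(1/20,η₁) ∧ TF(R,A) ∧ UP(eUp) ∧ T′_R(…, κ_T > 0, C_T) ⟹ AperiodicFrustratedLawGap`. [folklore] -/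
theorem aperiodicFrustratedLawGap_of_split_rangeCut {η₁ R A eUp κT CT : ℝ} (h01 : (1 : ℝ) / 20 ≤ η₁)
    (hDoor : Summit.AtomisticToContinuum.Crystallization.Theses.GrainCoreNetworkSplit.MuEquilibriumDoor)
    (hE : ElasticPricing (1 / 20) η₁) (hT : TailFloor R A) (hU : PeriodicEnergyCeiling eUp) (hκ : 0 < κT)
    (hF : FiniteRangeTopologicalPricing (1 / 20) η₁ R A eUp κT CT) :
    Summit.AtomisticToContinuum.Crystallization.Theses.FrustratedLawDichotomy.AperiodicFrustratedLawGap :=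
  aperiodicFrustratedLawGap_of_fdg hDoor (fdg_of_split_rangeCut h01 hE hT hU hκ hF)

/-- **The unsplit range cut, crux form**: `MuEquilibriumDoor ∧ TF(R,A) ∧ UP(eUp) ∧ FRG(R,A,e₁,C) ∧ (eUp < e₁) ⟹ AperiodicFrustratedLawGap`.
[folklore] -/
theorem aperiodicFrustratedLawGap_of_rangeCut {R A eUp e₁ C : ℝ}
    (hDoor : Summit.AtomisticToContinuum.Crystallization.Theses.GrainCoreNetworkSplit.MuEquilibriumDoor)
    (hT : TailFloor R A) (hU : PeriodicEnergyCeiling eUp) (hF : FiniteRangeFrustrationGap R A e₁ C) (he : eUp < e₁) :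
    Summit.AtomisticToContinuum.Crystallization.Theses.FrustratedLawDichotomy.AperiodicFrustratedLawGap :=
  aperiodicFrustratedLawGap_of_fdg hDoor (fdg_of_rangeCut hT hU hF he)

end Summit.AtomisticToContinuum.Crystallization.Theorems.FrustratedLawDichotomyRangeCut

end
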